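import Summits.FinalStateConjecture.FinalStateConjecture.Theorems.BartnikGapSettlingBondiBartnikRigidityRouteMarchingDefs
import Literature.Geometry.Lorentzian.IsometricImmersionOneJetRigidity
import Literature.Geometry.Lorentzian.OneJetEqualiser
import Literature.Geometry.Lorentzian.KerrSchildChartCovariance
import Literature.Geometry.Lorentzian.HypersurfaceRestriction
import HarnessLib

/-!
# K2b-3 `ExactChartGluing` (stub `stub_exactChartGluing`) — line `direct-method-on-the-cone`
# (crux `BondiBartnikRigidity`, stmt-FinalStateConjecture-10807)

The chart-gluing lemma of the marching route to the corrected F5 (`K2Route.ExactChartGluing`,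
`…RouteMarchingDefs.lean`): two EXACT charts `Ψ₁`, `Ψ₂` of the collar background
`B = starBackground Λ c M a (r_a ∘ (Λ, c)⁻¹)` into a spacetime `𝒮` — smooth on the pull-backs
`pullK Uᵢ` of open Kerr-side sets `Uᵢ` with vanishing order-`0` deviation there — which agree on the
pull-back of a nonempty open `A ⊆ U₁ ∩ U₂` agree on the pull-back of the CONNECTED overlap `U₁ ∩ U₂`.

Proof.  Order-`0` exactness says `Ψᵢ^* g = g_B` pointwise on `pullK Uᵢ`
(`metric_mfderiv_eq_bilin_of_supCkENorm_le_zero`).  On the open submanifold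
`O = pullK (U₁ ∩ U₂)` of `B.domain` (an `Opens`-subtype, model `𝓘(ℝ, E4)`) the boosted Kerr–Schild
form `g_B` is packaged as a `PseudoRiemannianMetric` (symmetric and nondegenerate from `Kerr.bilin`,
smooth because it equals the pull-back `(Ψ₁|_O)^* g`, `contMDiff_pullbackBilin_holds`), for which
both restrictions `Ψᵢ ∘ Subtype.val` are isometric immersions (`d(Subtype.val) = id`,
`mfderiv_comp_subtypeVal`).  `O` is connected: it is the image of `U₁ ∩ U₂` under the homeomorphic
identification `y ↦ Λ y + c` of `Kerr.region a M` with `B.domain`.  At a point of `pullK A` the two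
restrictions agree to first order (they agree on the open set `pullK A`,
`Filter.EventuallyEq.mfderiv_eq`), hence everywhere on `O` by the one-jet rigidity of isometric
immersions `PseudoRiemannianMetric.IsIsometricImmersion.eq_of_oneJet_eq` (O'Neill 1983, Ch. 3,
Prop. 3.62; Sbierski 2016, §3.1, first lemma).

References: O'Neill 1983, Ch. 3, Prop. 3.62 [ONeill1983]; Sbierski, Ann. Henri Poincaré 17 (2016),
§3.1 [Sbierski2016AHP]; Kerr–Schild 1965 (Lorentz covariance of the Kerr–Schild form) [KerrSchild1965].
No definitions, no named facts.
-/

noncomputable section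

-- D-0017: single-problem summit, `Summit.<S>.<S>.…` by design (cf. lakefile `weak.linter.dupNamespace`).
set_option linter.dupNamespace false
-- instance search through the nested operator types of the Kerr chart facts
set_option maxSynthPendingDepth 3

open Set Filter Function Topology TopologicalSpace Bundle
open Literature.Geometry.Lorentzian
open scoped Manifold ContDiff Topology ENNReal

namespace Summit.FinalStateConjecture.FinalStateConjecture.Theorems.BondiBartnikRigidity.DirectMethod

namespace K2Route

set_option synthInstance.maxHeartbeats 200000 in
/-- **Order-`0` exactness is a pointwise isometry condition**: if the `C⁰` sup norm of the
deviation `Ψ^* g − g_B` over (the image in `E4` of) `S ⊆ B.domain` vanishes, then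
`g(dΨ v, dΨ w) = g_B(v, w)` at every point of `S`. [cite: arXiv210408222, §1] -/
theorem metric_mfderiv_eq_bilin_of_supCkENorm_le_zero {𝒮 : Spacetime.{0} 4} {B : ModelBackground}
    {Ψ : B.domain → 𝒮.carrier} {S : Set B.domain}
    (h : supCkENorm (Subtype.val '' S) 0 (𝒮.deviationExtend B Ψ) ≤ 0) {x : B.domain} (hx : x ∈ S)
    (v w : E4) :
    𝒮.metric.val (Ψ x) (mfderiv 𝓘(ℝ, E4) (𝓡 4) Ψ x v) (mfderiv 𝓘(ℝ, E4) (𝓡 4) Ψ x w) =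
      B.bilin x.1 v w := by
  have hle := (enorm_iteratedFDeriv_le_supCkENorm (k := 0) (m := 0) le_rfl
    (mem_image_of_mem Subtype.val hx) (𝒮.deviationExtend B Ψ)).trans h
  have h0 : iteratedFDeriv ℝ 0 (𝒮.deviationExtend B Ψ) x.1 = 0 := by
    have := le_antisymm hle zero_le
    rwa [enorm_eq_zero] at this
  have h1 := congrArg (fun F => F Fin.elim0) h0
  simp only [iteratedFDeriv_zero_apply, Spacetime.deviationExtend_coe] at h1
  have h2 := congrArg (fun b => b v w) h1
  simp only [Spacetime.deviation_apply] at h2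
  exact sub_eq_zero.mp h2

/-- **The chart-gluing lemma `ExactChartGluing` holds** (step (D) of the marching route): two exact
charts of the collar background on `pullK U₁`, `pullK U₂` that agree on the pull-back of a nonempty
open `A ⊆ U₁ ∩ U₂` agree on the pull-back of the connected overlap `U₁ ∩ U₂` — both restrictions to
the connected open submanifold `pullK (U₁ ∩ U₂)` are isometric immersions of `(pullK (U₁ ∩ U₂), g_B)`
into `𝒮` with the same one-jet at a point of `pullK A`, hence equal by O'Neill's Prop. 3.62
(`PseudoRiemannianMetric.IsIsometricImmersion.eq_of_oneJet_eq`). [cite: ONeill1983, Ch. 3, Prop. 3.62] -/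
theorem exactChartGluing_holds : ExactChartGluing := by
  intro _ 𝒮 M a mo B Ψ₁ Ψ₂ U₁ U₂ A hM ha hB hU₁ hU₂ hconn hAo hAne hAsub hs₁ hd₁ hs₂ hd₂ hagree
  -- the rest-frame map and the background in coordinates
  set P : E4 → E4 := poincareInv mo.1 mo.2 with hP
  have hPlab : ∀ z : E4, P ((mo.1 : E4 ≃L[ℝ] E4) z + mo.2) = z := fun z => by
    simp [hP, poincareInv]
  have hlabP : ∀ x : E4, (mo.1 : E4 ≃L[ℝ] E4) (P x) + mo.2 = x := fun x => by
    simp [hP, poincareInv]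
  have hdom : ∀ x : E4, x ∈ B.domain ↔ P x ∈ Kerr.region a M := fun x => by rw [hB]; rfl
  have hbil : B.bilin = boostedKerrBilin mo.1 mo.2 M a := by rw [hB]; rfl
  have hPreg : ∀ x : B.domain, P x.1 ∈ Kerr.region a M := fun x => (hdom x.1).1 x.2
  -- the identification `θ : B.domain ≃ Kerr.region a M` and its inverse
  set θ : B.domain → Kerr.region a M := fun x => ⟨P x.1, hPreg x⟩
  set θi : Kerr.region a M → B.domain := fun y =>
    ⟨(mo.1 : E4 ≃L[ℝ] E4) y.1 + mo.2, (hdom _).2 (by rw [hPlab]; exact y.2)⟩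
  have hθi_cont : Continuous θi :=
    (((mo.1 : E4 ≃L[ℝ] E4).continuous.comp continuous_subtype_val).add continuous_const).subtype_mk _
  have hleft : LeftInverse θ θi := fun y => Subtype.ext (hPlab y.1)
  have hright : RightInverse θ θi := fun x => Subtype.ext (hlabP x.1)
  have hpull : ∀ S : Set (Kerr.region a M), pullK mo M a B S = θ ⁻¹' S := fun S => by
    ext x
    exact ⟨fun ⟨_, h⟩ => h, fun h => ⟨hPreg x, h⟩⟩
  have hpull' : ∀ S : Set (Kerr.region a M), pullK mo M a B S = θi '' S := fun S => by
    rw [hpull, ← congrFun (image_eq_preimage_of_inverse hleft hright) S]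
  -- openness of the pulled-back sets
  have hO₁ : IsOpen (pullK mo M a B U₁) := isOpen_pullK_of_eq hB hU₁
  have hO₂ : IsOpen (pullK mo M a B U₂) := isOpen_pullK_of_eq hB hU₂
  have hOA : IsOpen (pullK mo M a B A) := isOpen_pullK_of_eq hB hAo
  have hO12 : IsOpen (pullK mo M a B (U₁ ∩ U₂)) := isOpen_pullK_of_eq hB (hU₁.inter hU₂)
  -- the connected open submanifold `O = pullK (U₁ ∩ U₂)` of `B.domain`
  set O : Opens B.domain := ⟨pullK mo M a B (U₁ ∩ U₂), hO12⟩
  have hOconn : IsConnected (O : Set B.domain) := by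
    show IsConnected (pullK mo M a B (U₁ ∩ U₂))
    rw [hpull']
    exact hconn.image θi hθi_cont.continuousOn
  haveI : ConnectedSpace O := isConnected_iff_connectedSpace.mp hOconn
  have hOsub₁ : ∀ y : O, (y : B.domain) ∈ pullK mo M a B U₁ := fun y =>
    pullK_mono mo M a B inter_subset_left y.2
  have hOsub₂ : ∀ y : O, (y : B.domain) ∈ pullK mo M a B U₂ := fun y =>
    pullK_mono mo M a B inter_subset_right y.2
  -- differentiability of the charts on their (open) domains
  have hΨ₁d : ∀ x ∈ pullK mo M a B U₁, MDifferentiableAt 𝓘(ℝ, E4) (𝓡 4) Ψ₁ x := fun x hx =>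
    ((hs₁ x hx).contMDiffAt (hO₁.mem_nhds hx)).mdifferentiableAt (by simp)
  have hΨ₂d : ∀ x ∈ pullK mo M a B U₂, MDifferentiableAt 𝓘(ℝ, E4) (𝓡 4) Ψ₂ x := fun x hx =>
    ((hs₂ x hx).contMDiffAt (hO₂.mem_nhds hx)).mdifferentiableAt (by simp)
  -- the restricted charts `Ψᵢ|_O` are smooth
  have hψ₁s : ContMDiff 𝓘(ℝ, E4) (𝓡 4) ∞ (Ψ₁ ∘ Subtype.val : O → 𝒮.carrier) :=
    hs₁.comp_contMDiff contMDiff_subtype_val hOsub₁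
  have hψ₂s : ContMDiff 𝓘(ℝ, E4) (𝓡 4) ∞ (Ψ₂ ∘ Subtype.val : O → 𝒮.carrier) :=
    hs₂.comp_contMDiff contMDiff_subtype_val hOsub₂
  -- and pull `g` back to the boosted Kerr–Schild form (order-`0` exactness, `d(Subtype.val) = id`)
  have hpb₁ : ∀ y : O, pullbackBilin (I := 𝓡 4) (I' := 𝓘(ℝ, E4))
      (Ψ₁ ∘ Subtype.val : O → 𝒮.carrier) 𝒮.metric.val y = B.bilin y.1.1 := fun y => by
    ext v w
    rw [pullbackBilin_apply, mfderiv_comp_subtypeVal (hΨ₁d _ (hOsub₁ y))]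
    exact metric_mfderiv_eq_bilin_of_supCkENorm_le_zero hd₁ (hOsub₁ y) v w
  have hpb₂ : ∀ y : O, pullbackBilin (I := 𝓡 4) (I' := 𝓘(ℝ, E4))
      (Ψ₂ ∘ Subtype.val : O → 𝒮.carrier) 𝒮.metric.val y = B.bilin y.1.1 := fun y => by
    ext v w
    rw [pullbackBilin_apply, mfderiv_comp_subtypeVal (hΨ₂d _ (hOsub₂ y))]
    exact metric_mfderiv_eq_bilin_of_supCkENorm_le_zero hd₂ (hOsub₂ y) v w
  -- the boosted Kerr–Schild form is symmetric and nondegenerate on `B.domain`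
  have hsymm : ∀ x v w : E4, B.bilin x v w = B.bilin x w v := fun x v w => by
    rw [hbil, boostedKerrBilin_apply, boostedKerrBilin_apply]
    exact Kerr.bilin_symm _ _ _ _ _
  have hnd : ∀ (x : B.domain) (v : E4), (∀ w, B.bilin x.1 v w = 0) → v = 0 := fun x v hv => by
    have key : ∀ w' : E4,
        Kerr.bilin M a (poincareInv mo.1 mo.2 x.1) ((mo.1 : E4 ≃L[ℝ] E4).symm v) w' = 0 := fun w' => by
      have h := hv ((mo.1 : E4 ≃L[ℝ] E4) w')
      rw [hbil, boostedKerrBilin_apply, ContinuousLinearEquiv.symm_apply_apply] at h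
      exact h
    have hsu : (mo.1 : E4 ≃L[ℝ] E4).symm v = 0 :=
      Kerr.bilin_nondegenerate M a (Kerr.radius_pos_of_mem_region (hPreg x)) _ key
    simpa using congrArg (mo.1 : E4 ≃L[ℝ] E4) hsu
  -- `g_B|_O` as a pseudo-Riemannian metric on the open submanifold `O`
  let gO : PseudoRiemannianMetric 𝓘(ℝ, E4) ∞ E4 (TangentSpace 𝓘(ℝ, E4) : O → Type _) :=
    { val := fun y => B.bilin y.1.1
      symm := fun y v w => hsymm _ v w
      nondegenerate := fun y v hv => hnd y.1 v hv
      contMDiff :=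
        (PseudoRiemannianMetric.contMDiff_pullbackBilin_holds (I := 𝓡 4) (M := 𝒮.carrier)
            (I' := 𝓘(ℝ, E4)) (N := O) (n := ∞) (Ψ₁ ∘ Subtype.val : O → 𝒮.carrier) hψ₁s
            𝒮.metric.toPseudoRiemannianMetric).congr fun y => by rw [← hpb₁ y] }
  -- both restricted charts are isometric immersions of `(O, g_B)` into `𝒮`
  have h₁ : gO.IsIsometricImmersion 𝒮.metric.toPseudoRiemannianMetric
      (Ψ₁ ∘ Subtype.val : O → 𝒮.carrier) := ⟨hψ₁s, fun y => hpb₁ y⟩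
  have h₂ : gO.IsIsometricImmersion 𝒮.metric.toPseudoRiemannianMetric
      (Ψ₂ ∘ Subtype.val : O → 𝒮.carrier) := ⟨hψ₂s, fun y => hpb₂ y⟩
  -- a base point in `pullK A`, where the one-jets agree
  obtain ⟨p₀, hp₀⟩ := hAne
  have hp₀O : θi p₀ ∈ pullK mo M a B (U₁ ∩ U₂) := by
    rw [hpull]
    show θ (θi p₀) ∈ U₁ ∩ U₂
    rw [hleft p₀]
    exact hAsub hp₀
  have hp₀A : θi p₀ ∈ pullK mo M a B A := by
    rw [hpull]
    show θ (θi p₀) ∈ A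
    rw [hleft p₀]
    exact hp₀
  have hp : (Ψ₁ ∘ Subtype.val : O → 𝒮.carrier) ⟨θi p₀, hp₀O⟩ =
      (Ψ₂ ∘ Subtype.val : O → 𝒮.carrier) ⟨θi p₀, hp₀O⟩ := hagree _ hp₀A
  have hev : (Ψ₁ ∘ Subtype.val : O → 𝒮.carrier) =ᶠ[𝓝 (⟨θi p₀, hp₀O⟩ : O)]
      (Ψ₂ ∘ Subtype.val : O → 𝒮.carrier) := by
    have ho : IsOpen ((Subtype.val : O → B.domain) ⁻¹' pullK mo M a B A) :=
      hOA.preimage continuous_subtype_val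
    exact Filter.eventuallyEq_of_mem (ho.mem_nhds hp₀A) fun y hy => hagree y.1 hy
  have key : (Ψ₁ ∘ Subtype.val : O → 𝒮.carrier) = (Ψ₂ ∘ Subtype.val : O → 𝒮.carrier) :=
    PseudoRiemannianMetric.IsIsometricImmersion.eq_of_oneJet_eq rfl h₁ h₂ hp hev.mfderiv_eq
  intro x hx
  exact congrFun key ⟨x, hx⟩

end K2Route

/-- **Registered stub `stub_exactChartGluing` of the line `direct-method-on-the-cone`** (K2b-3):
the chart-gluing lemma `K2Route.ExactChartGluing` of the marching route to the corrected F5 — exact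
charts of the collar background agreeing on the pull-back of a nonempty open set agree on the
pull-back of the connected overlap (one-jet rigidity of isometric immersions, O'Neill 1983,
Prop. 3.62). [cite: ONeill1983, Ch. 3, Prop. 3.62] -/
theorem stub_exactChartGluing : K2Route.ExactChartGluing :=
  K2Route.exactChartGluing_holds

end Summit.FinalStateConjecture.FinalStateConjecture.Theorems.BondiBartnikRigidity.DirectMethod

end
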